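import Mathlib

/-!
# Branch pairs of one logarithm — algebraic toolkit (item stmt-Schanuel-0974, part 1/3)

Support file for `RigidCore.OneLogBranchRelationFinite` (Lemma B1 of card
period-lattice-rigidity-baker): the pure commutative algebra over an arbitrary field extension
`K ⊆ E` used by the "relation ideal" proof in
`RigidCoreOneLogBranchRelationFiniteCore.lean`.

What is here (all for `A = MvPolynomial (Fin 2) K = K[X₀, X₁]`):
* the shears `σ_{j,k} : P(X₀, X₁) ↦ P(X₀ + j X₁, X₀ + k X₁)` and their inverses `τ_{j,k}`, always
  written out as `MvPolynomial.aeval ![X 0 + C j * X 1, X 0 + C k * X 1]` resp.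
  `MvPolynomial.aeval ![C (k - j)⁻¹ * (C k * X 0 - C j * X 1), C (k - j)⁻¹ * (X 1 - X 0)]`
  (no new definitions), with `unshear_shear`, `shear_unshear`, the evaluation rules
  `aeval_shear`, `aeval_unshear`, and `irreducible_unshear`;
* `aeval_eq_eval_map`: evaluation at `(y, u)` through `MvPolynomial.finSuccEquiv`;
* `isAlgebraic_of_infinite_vanishing`: a nonzero `P ∈ K[X₀, X₁]` vanishing at `(y, u)` for
  infinitely many `y` forces `u` to be algebraic over `K`;
* `exists_irreducible_generator`: if `t` is transcendental over `K`, the ideal of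
  `P ∈ K[X₀, X₁]` with `P(L, t) = 0` is generated by one irreducible polynomial as soon as it is
  nonzero (minimal `X₀`-degree + `Polynomial.cancelLeads`; no Gauss lemma);
* `X_sub_X_dvd_of_aeval_diag_eq_zero`: `Q(X, X) = 0 ⇒ (X₀ - X₁) ∣ Q`.

Design: Mathlib only; no `def`s and no notation, so that the three files of the item are pure proof
files.
-/

-- `Summit.Schanuel.Schanuel` (summit = problem) trips core's duplicate-namespace linter.
set_option linter.dupNamespace false

namespace Summit.Schanuel.Schanuel.Theorems.OneLogBranch

open MvPolynomial

noncomputable section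

variable {K : Type*} [Field K]

/-- `τ_{j,k} ∘ σ_{j,k} = id` for `j ≠ k`, where `σ_{j,k} : P(X₀, X₁) ↦ P(X₀ + j·X₁, X₀ + k·X₁)`
is the shear and `τ_{j,k} : X₀ ↦ (k·X₀ - j·X₁)/(k - j)`, `X₁ ↦ (X₁ - X₀)/(k - j)` its inverse
(both written as `MvPolynomial.aeval` at explicit linear forms). -/
theorem unshear_shear {j k : K} (hjk : j ≠ k) (P : MvPolynomial (Fin 2) K) :
    aeval ![C (k - j)⁻¹ * (C k * X 0 - C j * X 1), C (k - j)⁻¹ * (X 1 - X 0)]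
      (aeval ![X 0 + C j * X 1, X 0 + C k * X 1] P : MvPolynomial (Fin 2) K) = P := by
  set σ : MvPolynomial (Fin 2) K →ₐ[K] MvPolynomial (Fin 2) K :=
    aeval ![X 0 + C j * X 1, X 0 + C k * X 1] with hσ
  set τ : MvPolynomial (Fin 2) K →ₐ[K] MvPolynomial (Fin 2) K :=
    aeval ![C (k - j)⁻¹ * (C k * X 0 - C j * X 1), C (k - j)⁻¹ * (X 1 - X 0)] with hτ
  have hn : (k - j) ≠ 0 := sub_ne_zero.mpr (Ne.symm hjk)
  have hC : C (k - j)⁻¹ * (C k - C j) = (1 : MvPolynomial (Fin 2) K) := by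
    rw [← map_sub, ← C_mul, inv_mul_cancel₀ hn, C_1]
  have h : τ.comp σ = AlgHom.id K _ := by
    apply algHom_ext
    intro i
    fin_cases i
    · simp only [hσ, hτ, AlgHom.comp_apply, aeval_X, Fin.zero_eta, Matrix.cons_val_zero,
        map_add, map_mul, aeval_C, algebraMap_eq, Matrix.cons_val_one, Matrix.cons_val_fin_one,
        AlgHom.id_apply]
      linear_combination (X 0 : MvPolynomial (Fin 2) K) * hC
    · simp only [hσ, hτ, AlgHom.comp_apply, aeval_X, Fin.mk_one, Matrix.cons_val_one,
        Matrix.cons_val_fin_one, map_add, map_mul, aeval_C, algebraMap_eq, Matrix.cons_val_zero,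
        AlgHom.id_apply]
      linear_combination (X 1 : MvPolynomial (Fin 2) K) * hC
  have := congrArg (fun f => f P) h
  simpa using this

/-- `σ_{j,k} ∘ τ_{j,k} = id` for `j ≠ k` (shear after inverse shear). -/
theorem shear_unshear {j k : K} (hjk : j ≠ k) (P : MvPolynomial (Fin 2) K) :
    aeval ![X 0 + C j * X 1, X 0 + C k * X 1]
      (aeval ![C (k - j)⁻¹ * (C k * X 0 - C j * X 1), C (k - j)⁻¹ * (X 1 - X 0)] P :
        MvPolynomial (Fin 2) K) = P := by
  set σ : MvPolynomial (Fin 2) K →ₐ[K] MvPolynomial (Fin 2) K :=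
    aeval ![X 0 + C j * X 1, X 0 + C k * X 1] with hσ
  set τ : MvPolynomial (Fin 2) K →ₐ[K] MvPolynomial (Fin 2) K :=
    aeval ![C (k - j)⁻¹ * (C k * X 0 - C j * X 1), C (k - j)⁻¹ * (X 1 - X 0)] with hτ
  have hn : (k - j) ≠ 0 := sub_ne_zero.mpr (Ne.symm hjk)
  have hC : C (k - j)⁻¹ * (C k - C j) = (1 : MvPolynomial (Fin 2) K) := by
    rw [← map_sub, ← C_mul, inv_mul_cancel₀ hn, C_1]
  have h : σ.comp τ = AlgHom.id K _ := by
    apply algHom_ext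
    intro i
    fin_cases i
    · simp only [hσ, hτ, AlgHom.comp_apply, aeval_X, Fin.zero_eta, Matrix.cons_val_zero,
        map_mul, map_sub, aeval_C, algebraMap_eq, Matrix.cons_val_one, Matrix.cons_val_fin_one,
        AlgHom.id_apply]
      linear_combination (X 0 : MvPolynomial (Fin 2) K) * hC
    · simp only [hσ, hτ, AlgHom.comp_apply, aeval_X, Fin.mk_one, Matrix.cons_val_one,
        Matrix.cons_val_fin_one, map_mul, map_sub, aeval_C, algebraMap_eq, Matrix.cons_val_zero,
        AlgHom.id_apply]
      linear_combination (X 1 : MvPolynomial (Fin 2) K) * hC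
  have := congrArg (fun f => f P) h
  simpa using this

/-- The inverse shear `τ_{j,k}` preserves irreducibility (it is an algebra automorphism for
`j ≠ k`). -/
theorem irreducible_unshear {j k : K} (hjk : j ≠ k) {h : MvPolynomial (Fin 2) K}
    (hh : Irreducible h) :
    Irreducible (aeval ![C (k - j)⁻¹ * (C k * X 0 - C j * X 1), C (k - j)⁻¹ * (X 1 - X 0)] h :
      MvPolynomial (Fin 2) K) := by
  let e : MvPolynomial (Fin 2) K ≃ₐ[K] MvPolynomial (Fin 2) K :=
    AlgEquiv.ofAlgHom
      (aeval ![C (k - j)⁻¹ * (C k * X 0 - C j * X 1), C (k - j)⁻¹ * (X 1 - X 0)])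
      (aeval ![X 0 + C j * X 1, X 0 + C k * X 1])
      (by
        apply AlgHom.ext
        intro P
        rw [AlgHom.comp_apply, AlgHom.id_apply]
        exact unshear_shear hjk P)
      (by
        apply AlgHom.ext
        intro P
        rw [AlgHom.comp_apply, AlgHom.id_apply]
        exact shear_unshear hjk P)
  exact (MulEquiv.irreducible_iff e).mpr hh

variable {E : Type*} [Field E] [Algebra K E]

/-- Evaluating a sheared polynomial: `(σ_{j,k} P)(x, y) = P(x + j y, x + k y)`. -/
theorem aeval_shear (j k : K) (x y : E) (P : MvPolynomial (Fin 2) K) :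
    aeval ![x, y] (aeval ![X 0 + C j * X 1, X 0 + C k * X 1] P : MvPolynomial (Fin 2) K) =
      aeval ![x + algebraMap K E j * y, x + algebraMap K E k * y] P := by
  have h : (aeval ![x, y]).comp
      (aeval ![X 0 + C j * X 1, X 0 + C k * X 1] :
        MvPolynomial (Fin 2) K →ₐ[K] MvPolynomial (Fin 2) K) =
      aeval ![x + algebraMap K E j * y, x + algebraMap K E k * y] := by
    rw [comp_aeval]
    congr 1
    funext i
    fin_cases i <;> simp
  simpa using congrArg (fun f => f P) h

/-- Evaluating an unsheared polynomial:
`(τ_{j,k} P)(x, y) = P((k x - j y)/(k - j), (y - x)/(k - j))`. -/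
theorem aeval_unshear (j k : K) (x y : E) (P : MvPolynomial (Fin 2) K) :
    aeval ![x, y] (aeval ![C (k - j)⁻¹ * (C k * X 0 - C j * X 1), C (k - j)⁻¹ * (X 1 - X 0)] P :
      MvPolynomial (Fin 2) K) =
      aeval ![algebraMap K E (k - j)⁻¹ * (algebraMap K E k * x - algebraMap K E j * y),
        algebraMap K E (k - j)⁻¹ * (y - x)] P := by
  have h : (aeval ![x, y]).comp
      (aeval ![C (k - j)⁻¹ * (C k * X 0 - C j * X 1), C (k - j)⁻¹ * (X 1 - X 0)] :
        MvPolynomial (Fin 2) K →ₐ[K] MvPolynomial (Fin 2) K) =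
      aeval ![algebraMap K E (k - j)⁻¹ * (algebraMap K E k * x - algebraMap K E j * y),
        algebraMap K E (k - j)⁻¹ * (y - x)] := by
    rw [comp_aeval]
    congr 1
    funext i
    fin_cases i <;> simp
  simpa using congrArg (fun f => f P) h

/-- Evaluation of a bivariate polynomial at `(y, u)` through `finSuccEquiv`: first evaluate the
coefficients (polynomials in `X₁`) at `u`, then the outer variable at `y`. -/
theorem aeval_eq_eval_map (P : MvPolynomial (Fin 2) K) (y u : E) :
    aeval ![y, u] P =
      ((finSuccEquiv K 1 P).map
        (aeval ![u] : MvPolynomial (Fin 1) K →ₐ[K] E).toRingHom).eval y := by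
  set Φ : MvPolynomial (Fin 2) K →ₐ[K] E :=
    ((Polynomial.aeval y).restrictScalars K).comp
      ((Polynomial.mapAlgHom (aeval ![u] : MvPolynomial (Fin 1) K →ₐ[K] E)).comp
        (finSuccEquiv K 1 : MvPolynomial (Fin 2) K →ₐ[K] Polynomial (MvPolynomial (Fin 1) K)))
    with hΦ
  have h1 : (aeval ![y, u] : MvPolynomial (Fin 2) K →ₐ[K] E) = Φ := by
    apply algHom_ext
    intro i
    fin_cases i
    · simp [hΦ, finSuccEquiv_X_zero]
    · have : (X 1 : MvPolynomial (Fin 2) K) = X (Fin.succ 0) := rfl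
      simp [hΦ, this, finSuccEquiv_X_succ]
  rw [h1, hΦ]
  simp [Polynomial.coe_mapAlgHom]

/-- **Vanishing lemma.** If a nonzero `P ∈ K[X₀, X₁]` vanishes at `(y, u)` for infinitely many
`y`, then `u` is algebraic over `K`. -/
theorem isAlgebraic_of_infinite_vanishing {P : MvPolynomial (Fin 2) K} (hP : P ≠ 0) {u : E}
    {T : Set E} (hT : T.Infinite) (h0 : ∀ y ∈ T, aeval ![y, u] P = 0) : IsAlgebraic K u := by
  set φ : MvPolynomial (Fin 1) K →ₐ[K] E := aeval ![u] with hφ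
  set f : Polynomial E := (finSuccEquiv K 1 P).map φ.toRingHom with hf
  have hf0 : f = 0 := by
    refine Polynomial.eq_zero_of_infinite_isRoot f (hT.mono ?_)
    intro y hy
    simp only [Set.mem_setOf_eq, Polynomial.IsRoot.def, hf, hφ]
    rw [← aeval_eq_eval_map]
    exact h0 y hy
  have hP' : finSuccEquiv K 1 P ≠ 0 := (EmbeddingLike.map_ne_zero_iff).mpr hP
  obtain ⟨i, hi⟩ : ∃ i, (finSuccEquiv K 1 P).coeff i ≠ 0 := by
    by_contra hcon
    push Not at hcon
    exact hP' (Polynomial.ext (by simpa using hcon))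
  have hci : φ ((finSuccEquiv K 1 P).coeff i) = 0 := by
    have := congrArg (fun g => Polynomial.coeff g i) hf0
    simpa [hf, Polynomial.coeff_map] using this
  by_contra htr
  have hind : AlgebraicIndependent K ![u] := algebraicIndependent_iff_transcendental.mpr htr
  exact hi ((algebraicIndependent_iff.mp hind) _ hci)

/-- If `t` is transcendental over `K` and `r ∈ K[X₀]` (one variable) vanishes at `t`, then
`r = 0`. -/
theorem eq_zero_of_aeval_eq_zero {t : E} (ht : Transcendental K t) {r : MvPolynomial (Fin 1) K}
    (hr : aeval ![t] r = 0) : r = 0 :=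
  (algebraicIndependent_iff.mp (algebraicIndependent_iff_transcendental.mpr ht)) r hr

/-- **Generator lemma.** If `t` is transcendental over `K` and some nonzero `P₀ ∈ K[X₀, X₁]`
vanishes at `(L, t)`, then there is an irreducible `h` vanishing at `(L, t)` which divides every
polynomial vanishing at `(L, t)` (the relation ideal of `(L, t)` is principal). Proof by minimal
degree in `X₀` and cancellation of leading coefficients — no Gauss lemma needed. -/
theorem exists_irreducible_generator {L t : E} (ht : Transcendental K t)
    {P₀ : MvPolynomial (Fin 2) K} (hP₀ : P₀ ≠ 0) (hP₀' : aeval ![L, t] P₀ = 0) :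
    ∃ h : MvPolynomial (Fin 2) K, Irreducible h ∧ aeval ![L, t] h = 0 ∧
      ∀ P : MvPolynomial (Fin 2) K, aeval ![L, t] P = 0 → h ∣ P := by
  classical
  set e := finSuccEquiv K 1 with he
  set φ : MvPolynomial (Fin 1) K →ₐ[K] E := aeval ![t] with hφ
  set ψ : Polynomial (MvPolynomial (Fin 1) K) →+* E := Polynomial.eval₂RingHom φ.toRingHom L
    with hψ
  have hψe : ∀ P : MvPolynomial (Fin 2) K, aeval ![L, t] P = ψ (e P) := by
    intro P
    rw [aeval_eq_eval_map, Polynomial.eval_map]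
    rfl
  set I : Ideal (Polynomial (MvPolynomial (Fin 1) K)) := RingHom.ker ψ with hI
  have hIprime : I.IsPrime := RingHom.ker_isPrime ψ
  -- constants in `I` vanish
  have hIC : ∀ r : MvPolynomial (Fin 1) K, Polynomial.C r ∈ I → r = 0 := by
    intro r hr
    rw [hI, RingHom.mem_ker, hψ, Polynomial.coe_eval₂RingHom, Polynomial.eval₂_C] at hr
    exact eq_zero_of_aeval_eq_zero ht hr
  -- nonzero elements of `I` have positive degree
  have hIdeg : ∀ f ∈ I, f ≠ 0 → 0 < f.natDegree := by
    intro f hf hf0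
    by_contra hdeg
    push Not at hdeg
    have hdeg0 : f.natDegree = 0 := Nat.le_zero.mp hdeg
    have hfC := Polynomial.eq_C_of_natDegree_eq_zero hdeg0
    have : f.coeff 0 = 0 := hIC _ (hfC ▸ hf)
    exact hf0 (by rw [hfC, this, map_zero])
  -- minimal degree
  have hex : ∃ d, ∃ f ∈ I, f ≠ 0 ∧ f.natDegree = d :=
    ⟨_, e P₀, by rw [hI, RingHom.mem_ker, ← hψe]; exact hP₀',
      (EmbeddingLike.map_ne_zero_iff).mpr hP₀, rfl⟩
  obtain ⟨f₁, hf₁I, hf₁0, hf₁d⟩ := Nat.find_spec hex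
  have hmin : ∀ g ∈ I, g ≠ 0 → Nat.find hex ≤ g.natDegree :=
    fun g hg hg0 => Nat.find_min' hex ⟨g, hg, hg0, rfl⟩
  set d := Nat.find hex with hd
  -- an irreducible factor of `f₁` inside `I`
  obtain ⟨u, hu⟩ := UniqueFactorizationMonoid.factors_prod hf₁0
  have hprodI : (UniqueFactorizationMonoid.factors f₁).prod ∈ I := by
    have h1 : (UniqueFactorizationMonoid.factors f₁).prod * ↑u ∈ I := by rw [hu]; exact hf₁I
    rcases hIprime.mem_or_mem h1 with h2 | h2
    · exact h2
    · exact absurd (Ideal.eq_top_of_isUnit_mem I h2 u.isUnit) hIprime.ne_top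
  obtain ⟨f, hfmem, hfI⟩ := (hIprime.multiset_prod_mem_iff_exists_mem _).mp hprodI
  have hfirr : Irreducible f := UniqueFactorizationMonoid.irreducible_of_factor f hfmem
  have hfdvd : f ∣ f₁ := UniqueFactorizationMonoid.dvd_of_mem_factors hfmem
  have hf0 : f ≠ 0 := hfirr.ne_zero
  have hfd : f.natDegree = d :=
    le_antisymm (hf₁d ▸ Polynomial.natDegree_le_of_dvd hfdvd hf₁0) (hmin f hfI hf0)
  have hfpos : 0 < f.natDegree := hIdeg f hfI hf0
  have hfprime : Prime f := hfirr.prime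
  -- `f` divides every element of `I`, by induction on the degree
  have key : ∀ n : ℕ, ∀ g ∈ I, g.natDegree ≤ n → f ∣ g := by
    intro n
    induction n with
    | zero =>
      intro g hg hgn
      rcases eq_or_ne g 0 with rfl | hg0
      · exact dvd_zero f
      · exact absurd (hIdeg g hg hg0) (by omega)
    | succ n ih =>
      intro g hg hgn
      rcases eq_or_ne g 0 with rfl | hg0
      · exact dvd_zero f
      have hdg : f.natDegree ≤ g.natDegree := hfd ▸ hmin g hg hg0
      have hgpos : 0 < g.natDegree := lt_of_lt_of_le hfpos hdg
      set g' := f.cancelLeads g with hg'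
      have hg'deg : g'.natDegree < g.natDegree :=
        Polynomial.natDegree_cancelLeads_lt_of_natDegree_le_natDegree hdg hgpos
      have hg'I : g' ∈ I := by
        rw [hg', Polynomial.cancelLeads]
        exact I.sub_mem (I.mul_mem_left _ hg) (I.mul_mem_left _ hfI)
      have hfg' : f ∣ g' := ih g' hg'I (by omega)
      have hsub : f.natDegree - g.natDegree = 0 := Nat.sub_eq_zero_of_le hdg
      have hsum : Polynomial.C f.leadingCoeff * g =
          g' + Polynomial.C g.leadingCoeff * Polynomial.X ^ (g.natDegree - f.natDegree) * f := by
        rw [hg', Polynomial.cancelLeads, hsub, pow_zero, mul_one]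
        ring
      have hdvd1 : f ∣ Polynomial.C f.leadingCoeff * g := by
        rw [hsum]
        exact dvd_add hfg' (dvd_mul_left f _)
      rcases hfprime.dvd_or_dvd hdvd1 with h1 | h1
      · exfalso
        have hlc : Polynomial.C f.leadingCoeff ≠ 0 := by
          rw [Ne, Polynomial.C_eq_zero, Polynomial.leadingCoeff_eq_zero]
          exact hf0
        have := Polynomial.natDegree_le_of_dvd h1 hlc
        rw [Polynomial.natDegree_C] at this
        omega
      · exact h1
  -- transport back
  refine ⟨e.symm f, (MulEquiv.irreducible_iff e.symm).mpr hfirr, ?_, ?_⟩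
  · rw [hψe, AlgEquiv.apply_symm_apply]
    exact hfI
  · intro P hP
    have hPI : e P ∈ I := by rw [hI, RingHom.mem_ker, ← hψe]; exact hP
    have := key _ (e P) hPI le_rfl
    simpa using map_dvd e.symm this

/-- If `Q(X₀, X₀) = 0` then `X₀ - X₁ ∣ Q`. -/
theorem X_sub_X_dvd_of_aeval_diag_eq_zero {Q : MvPolynomial (Fin 2) K}
    (hQ : aeval (fun _ : Fin 2 => (X 0 : MvPolynomial (Fin 1) K)) Q = 0) :
    (X 0 - X 1 : MvPolynomial (Fin 2) K) ∣ Q := by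
  -- shear `ρ : Q(X₀, X₁) ↦ Q(X₀ + X₁, X₁)` with inverse `ρ'`
  set ρ : MvPolynomial (Fin 2) K →ₐ[K] MvPolynomial (Fin 2) K := aeval ![X 0 + X 1, X 1] with hρ
  set ρ' : MvPolynomial (Fin 2) K →ₐ[K] MvPolynomial (Fin 2) K := aeval ![X 0 - X 1, X 1] with hρ'
  have hρρ : ∀ P, ρ' (ρ P) = P := by
    intro P
    have h : ρ'.comp ρ = AlgHom.id K _ := by
      apply algHom_ext
      intro i
      fin_cases i <;> simp [hρ, hρ']
    simpa using congrArg (fun f => f P) h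
  set e := finSuccEquiv K 1 with he
  -- the constant coefficient of `e (ρ Q)` is `Q(X₀, X₀)`
  have hcoeff : (e (ρ Q)).coeff 0 = 0 := by
    rw [Polynomial.coeff_zero_eq_eval_zero]
    have h : ((Polynomial.aeval (0 : MvPolynomial (Fin 1) K)).restrictScalars K).comp
        ((e : MvPolynomial (Fin 2) K →ₐ[K] Polynomial (MvPolynomial (Fin 1) K)).comp ρ) =
        aeval (fun _ : Fin 2 => (X 0 : MvPolynomial (Fin 1) K)) := by
      apply algHom_ext
      intro i
      fin_cases i
      · have : (X 1 : MvPolynomial (Fin 2) K) = X (Fin.succ 0) := rfl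
        simp [hρ, he, this, finSuccEquiv_X_zero, finSuccEquiv_X_succ]
      · have : (X 1 : MvPolynomial (Fin 2) K) = X (Fin.succ 0) := rfl
        simp [hρ, he, this, finSuccEquiv_X_succ]
    have := congrArg (fun f => f Q) h
    rw [hQ] at this
    simpa using this
  have hX : (X 0 : MvPolynomial (Fin 2) K) ∣ ρ Q := by
    have h1 : Polynomial.X ∣ e (ρ Q) := Polynomial.X_dvd_iff.mpr hcoeff
    have h2 := map_dvd e.symm h1
    rwa [AlgEquiv.symm_apply_apply, ← finSuccEquiv_X_zero, ← he, AlgEquiv.symm_apply_apply] at h2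
  have h3 := map_dvd ρ' hX
  rwa [hρρ, show ρ' (X 0) = X 0 - X 1 by simp [hρ']] at h3

end

end Summit.Schanuel.Schanuel.Theorems.OneLogBranch
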